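import Summits.CriticalPhenomena.PercolationContinuityZ3.Theorems.PercNearOneGluingNoHeavyLowerTailSahiOneStepGoodPivot
import Summits.CriticalPhenomena.PercolationContinuityZ3.Theorems.PercNearOneGluingNoHeavyLowerTailSahiOneStepSubblockThreshold
import Summits.CriticalPhenomena.PercolationContinuityZ3.Theorems.PercNearOneGluingNoHeavyLowerTailSahiOneStepThresholdsMLR
import HarnessLib

/-!
# One-step scheme: grid and measure lemmas for the ONE-HEAVY-VOTER family (band pivotal sets)

Prover prim-ineq-prove-3 gen 27 (`--supports stmt-CriticalPhenomena-4575`; memo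
`run/shared/lean/prim/prim-ineq-prove-3/FINDING-G27-PIVOT-CERTIFICATE.md` §2).  No definitions, no sorries.

For a sub-block `T ⊆ F` and nested thresholds `B¹ = {N_T ≥ m₁} ⊇ B⁰ = {N_T ≥ m₀}` (`m₁ ≤ m₀`), with `L¹ = {N_F < t}`,
`L⁰ = {N_F < t+1}`, the two hypotheses of the good-pivot step (`osN_threshold_goodPivot_step`) hold:
* LEMMA X (`real_ball_mul_threshSucc_inter_ball_le`): `μL¹·μ({N_T ≥ m+1} ∩ L⁰) ≤ μL⁰·μ({N_T ≥ m} ∩ L¹)` — the cells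
  `{N_T = k} ∩ {N_{F∖T} = j}` reduce it to the grid lemma `hv_gridX`, proved from the log-concavity of the law of `N_T`
  (`real_layer_logConcave`) and the MLR tail comparison `ThreshGrid.mlr_sum_le`;
* LEMMA Ψ (`heavyVoter_psi`): `ℓ¹(1−b¹)(ℓ⁰b⁰ − μ(B⁰∩L⁰)) ≤ ℓ⁰(1−b⁰)(ℓ¹b¹ − μ(B¹∩L¹))`, from (a) `real_low_inter_ball_mul_le`
  (conditioning `N_T` to be smaller makes the ball likelier; grid lemma `hv_gridA`) and (b) ball monotonicity
  `real_inter_ball_mul_le_succ`.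
The companion file `…SahiOneStepHeavyVoter` concludes `(2′)` and Kahn C5 / Sahi `C₃` for the weighted thresholds
`{(m₀−m₁)·x_a + N_T ≥ m₀}` against every increasing event.
-/

noncomputable section

namespace Summit.CriticalPhenomena.PercolationContinuityZ3.Theorems

namespace SahiOneStep

open MeasureTheory Finset
open scoped Classical

/-! ## Grid lemmas for the one-heavy-voter family (pure finite sums) -/

/-- Inner ball sum `G r k = Σ_{j ≤ J} [k + j < r]·b j`: nonnegative. [this work] -/
theorem hvG_nonneg (J : ℕ) (b : ℕ → ℝ) (hb : ∀ j, 0 ≤ b j) (r k : ℕ) :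
    0 ≤ ∑ j ∈ range (J + 1), (if k + j < r then b j else 0) :=
  Finset.sum_nonneg fun j _ => by split_ifs <;> [exact hb j; exact le_rfl]

/-- Inner ball sum is antitone in `k`. [this work] -/
theorem hvG_anti (J : ℕ) (b : ℕ → ℝ) (hb : ∀ j, 0 ≤ b j) (r : ℕ) {k k' : ℕ} (hkk' : k ≤ k') :
    ∑ j ∈ range (J + 1), (if k' + j < r then b j else 0) ≤ ∑ j ∈ range (J + 1), (if k + j < r then b j else 0) :=
  Finset.sum_le_sum fun j _ => by
    by_cases h' : k' + j < r
    · rw [if_pos h', if_pos (by omega)]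
    · rw [if_neg h']; split_ifs <;> [exact hb j; exact le_rfl]

/-- Shift of the inner ball sum: `G (r+1) (k+1) = G r k`. [this work] -/
theorem hvG_shift (J : ℕ) (b : ℕ → ℝ) (r k : ℕ) :
    ∑ j ∈ range (J + 1), (if k + 1 + j < r + 1 then b j else 0) = ∑ j ∈ range (J + 1), (if k + j < r then b j else 0) :=
  Finset.sum_congr rfl fun j _ => by
    by_cases h : k + j < r
    · rw [if_pos h, if_pos (by omega)]
    · rw [if_neg h, if_neg (by omega)]

/-- Row reduction: `Σ_j [P ∧ k+j<r] a_k b_j = [P]·a_k·G r k`. [this work] -/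
theorem hv_row (J : ℕ) (a b : ℕ → ℝ) (P : Prop) [Decidable P] (r k : ℕ) :
    ∑ j ∈ range (J + 1), (if P ∧ k + j < r then a k * b j else 0) =
      if P then a k * ∑ j ∈ range (J + 1), (if k + j < r then b j else 0) else 0 := by
  by_cases hP : P
  · rw [if_pos hP, Finset.mul_sum]
    refine Finset.sum_congr rfl fun j _ => ?_
    by_cases h : k + j < r
    · rw [if_pos ⟨hP, h⟩, if_pos h]
    · rw [if_neg (fun h2 => h h2.2), if_neg h, mul_zero]
  · rw [if_neg hP]
    exact Finset.sum_eq_zero fun j _ => if_neg fun h2 => hP h2.1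

/-- **GRID LEMMA X** (log-concavity of the block law + MLR tail comparison): for nonnegative `a, b` with `a` log-concave and
`a (K+1) = 0`,  `S(∅,t)·S(m+1,t+1) ≤ S(∅,t+1)·S(m,t)` where `S(m,r) = Σ_{k ≤ K, j ≤ J} [m ≤ k][k + j < r] a_k b_j`. [this work] -/
theorem hv_gridX (K J : ℕ) (a b : ℕ → ℝ) (ha : ∀ k, 0 ≤ a k) (hb : ∀ j, 0 ≤ b j)
    (halc : ∀ i j, i < j → a i * a (j + 1) ≤ a (i + 1) * a j) (haK : a (K + 1) = 0) (m t : ℕ) :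
    (∑ k ∈ range (K + 1), ∑ j ∈ range (J + 1), (if k + j < t then a k * b j else 0)) *
        (∑ k ∈ range (K + 1), ∑ j ∈ range (J + 1), (if m + 1 ≤ k ∧ k + j < t + 1 then a k * b j else 0)) ≤
      (∑ k ∈ range (K + 1), ∑ j ∈ range (J + 1), (if k + j < t + 1 then a k * b j else 0)) *
        (∑ k ∈ range (K + 1), ∑ j ∈ range (J + 1), (if m ≤ k ∧ k + j < t then a k * b j else 0)) := by
  set G : ℕ → ℕ → ℝ := fun r k => ∑ j ∈ range (J + 1), (if k + j < r then b j else 0) with hG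
  have hG0 : ∀ r k, 0 ≤ G r k := fun r k => hvG_nonneg J b hb r k
  -- row reductions
  have rowAll : ∀ r, (∑ k ∈ range (K + 1), ∑ j ∈ range (J + 1), (if k + j < r then a k * b j else 0)) =
      ∑ k ∈ range (K + 1), a k * G r k := fun r => by
    refine Finset.sum_congr rfl fun k _ => ?_
    rw [Finset.mul_sum]
    refine Finset.sum_congr rfl fun j _ => ?_
    by_cases h : k + j < r
    · rw [if_pos h, if_pos h]
    · rw [if_neg h, if_neg h, mul_zero]
  have rowP : ∀ m' r, (∑ k ∈ range (K + 1), ∑ j ∈ range (J + 1), (if m' ≤ k ∧ k + j < r then a k * b j else 0)) =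
      ∑ k ∈ range (K + 1), (if m' ≤ k then a k * G r k else 0) := fun m' r =>
    Finset.sum_congr rfl fun k _ => hv_row J a b (m' ≤ k) r k
  rw [rowAll t, rowAll (t + 1), rowP (m + 1) (t + 1), rowP m t]
  -- the sequences u, v and the indicator φ
  set u : ℕ → ℝ := fun k => a k * G t k with hu
  set v : ℕ → ℝ := fun k => a (k + 1) * G t k with hv
  set φ : ℕ → ℝ := fun k => if m ≤ k then 1 else 0 with hφ
  have hu0 : ∀ k, 0 ≤ u k := fun k => mul_nonneg (ha k) (hG0 t k)
  have hv0 : ∀ k, 0 ≤ v k := fun k => mul_nonneg (ha (k + 1)) (hG0 t k)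
  have hφ0 : ∀ k, 0 ≤ φ k := fun k => by simp only [hφ]; split_ifs <;> norm_num
  -- (1) S(m+1,t+1) = Σ_{k<K} [m ≤ k] v k ≤ Σ_{k<K+1} v k φ k
  have hshift : ∀ k, G (t + 1) (k + 1) = G t k := fun k => hvG_shift J b t k
  have e1 : (∑ k ∈ range (K + 1), (if m + 1 ≤ k then a k * G (t + 1) k else 0)) =
      ∑ k ∈ range K, v k * φ k := by
    rw [Finset.sum_range_succ']
    have h0 : (if m + 1 ≤ 0 then a 0 * G (t + 1) 0 else 0) = 0 := if_neg (by omega)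
    rw [h0, add_zero]
    refine Finset.sum_congr rfl fun k _ => ?_
    simp only [hv, hφ]
    by_cases hm : m ≤ k
    · rw [if_pos (by omega), if_pos hm, mul_one, hshift]
    · rw [if_neg (by omega), if_neg hm, mul_zero]
  have le1 : ∑ k ∈ range K, v k * φ k ≤ ∑ k ∈ range (K + 1), v k * φ k := by
    rw [Finset.sum_range_succ]
    exact le_add_of_nonneg_right (mul_nonneg (hv0 K) (hφ0 K))
  -- (2) Σ_{k<K+1} v k ≤ S(∅,t+1)
  have hvK : v K = 0 := by simp only [hv, haK, zero_mul]
  have le2 : ∑ k ∈ range (K + 1), v k ≤ ∑ k ∈ range (K + 1), a k * G (t + 1) k := by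
    rw [Finset.sum_range_succ, hvK, add_zero, Finset.sum_range_succ' (fun k => a k * G (t + 1) k)]
    have : ∑ k ∈ range K, v k = ∑ k ∈ range K, a (k + 1) * G (t + 1) (k + 1) :=
      Finset.sum_congr rfl fun k _ => by simp only [hv, hshift]
    rw [this]
    exact le_add_of_nonneg_right (mul_nonneg (ha 0) (hG0 (t + 1) 0))
  -- (3) S(m,t) = Σ u k φ k
  have e3 : (∑ k ∈ range (K + 1), (if m ≤ k then a k * G t k else 0)) = ∑ k ∈ range (K + 1), u k * φ k :=
    Finset.sum_congr rfl fun k _ => by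
      simp only [hu, hφ]; split_ifs <;> simp
  -- (4) MLR: (Σ u)(Σ v φ) ≤ (Σ v)(Σ u φ)
  have hmlr : ∀ i j, i ≤ j → v j * u i ≤ v i * u j := by
    intro i j hij
    simp only [hu, hv]
    rcases Nat.lt_or_eq_of_le hij with hlt | heq
    · have h := halc i j hlt
      have hGG : 0 ≤ G t i * G t j := mul_nonneg (hG0 t i) (hG0 t j)
      nlinarith
    · subst heq; exact le_rfl
  have hφmono : ∀ i j, i ≤ j → j < K + 1 → (v i ≠ 0 ∨ u i ≠ 0) → (v j ≠ 0 ∨ u j ≠ 0) → φ i ≤ φ j := by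
    intro i j hij _ _ _
    simp only [hφ]
    by_cases hi : m ≤ i
    · rw [if_pos hi, if_pos (le_trans hi hij)]
    · rw [if_neg hi]; split_ifs <;> norm_num
  have key := ThreshGrid.mlr_sum_le (K + 1) v u φ hmlr hφmono
  -- assemble
  rw [e1, e3]
  have hSu0 : 0 ≤ ∑ k ∈ range (K + 1), u k := Finset.sum_nonneg fun k _ => hu0 k
  have hSuφ0 : 0 ≤ ∑ k ∈ range (K + 1), u k * φ k := Finset.sum_nonneg fun k _ => mul_nonneg (hu0 k) (hφ0 k)
  calc (∑ k ∈ range (K + 1), a k * G t k) * ∑ k ∈ range K, v k * φ k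
      ≤ (∑ k ∈ range (K + 1), u k) * ∑ k ∈ range (K + 1), v k * φ k := by
        exact mul_le_mul_of_nonneg_left le1 hSu0
    _ ≤ (∑ k ∈ range (K + 1), v k) * ∑ k ∈ range (K + 1), u k * φ k := key
    _ ≤ (∑ k ∈ range (K + 1), a k * G (t + 1) k) * ∑ k ∈ range (K + 1), u k * φ k :=
        mul_le_mul_of_nonneg_right le2 hSuφ0

/-- **GRID LEMMA (a)** (the lower corner `{k < m}` is more concentrated in the ball for smaller `m`): for nonnegative `a, b` and
`m₁ ≤ m₀`,  `SA(m₀)·SD(m₁) ≤ SA(m₁)·SD(m₀)` with `SA(m) = Σ [k<m][k+j<t] a b`, `SD(m) = Σ [k<m] a b`. [this work] -/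
theorem hv_gridA (K J : ℕ) (a b : ℕ → ℝ) (ha : ∀ k, 0 ≤ a k) (hb : ∀ j, 0 ≤ b j) {m₁ m₀ : ℕ} (hm : m₁ ≤ m₀) (t : ℕ) :
    (∑ k ∈ range (K + 1), ∑ j ∈ range (J + 1), (if k < m₀ ∧ k + j < t then a k * b j else 0)) *
        (∑ k ∈ range (K + 1), ∑ j ∈ range (J + 1), (if k < m₁ then a k * b j else 0)) ≤
      (∑ k ∈ range (K + 1), ∑ j ∈ range (J + 1), (if k < m₁ ∧ k + j < t then a k * b j else 0)) *
        (∑ k ∈ range (K + 1), ∑ j ∈ range (J + 1), (if k < m₀ then a k * b j else 0)) := by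
  set G : ℕ → ℝ := fun k => ∑ j ∈ range (J + 1), (if k + j < t then b j else 0) with hG
  set Bs : ℝ := ∑ j ∈ range (J + 1), b j with hBs
  have hG0 : ∀ k, 0 ≤ G k := fun k => hvG_nonneg J b hb t k
  have hBs0 : 0 ≤ Bs := Finset.sum_nonneg fun j _ => hb j
  have rowP : ∀ m', (∑ k ∈ range (K + 1), ∑ j ∈ range (J + 1), (if k < m' ∧ k + j < t then a k * b j else 0)) =
      ∑ k ∈ range (K + 1), (if k < m' then a k * G k else 0) := fun m' =>
    Finset.sum_congr rfl fun k _ => hv_row J a b (k < m') t k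
  have rowD : ∀ m', (∑ k ∈ range (K + 1), ∑ j ∈ range (J + 1), (if k < m' then a k * b j else 0)) =
      ∑ k ∈ range (K + 1), (if k < m' then a k * Bs else 0) := fun m' => by
    refine Finset.sum_congr rfl fun k _ => ?_
    by_cases h : k < m'
    · rw [if_pos h, Finset.mul_sum]
      exact Finset.sum_congr rfl fun j _ => if_pos h
    · rw [if_neg h]
      exact Finset.sum_eq_zero fun j _ => if_neg h
  rw [rowP m₀, rowP m₁, rowD m₁, rowD m₀]
  -- sequences on the window k < m₀:  h = [k<m₀] a G,  h' = [k<m₀] a Bs, φ = [m₁ ≤ k]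
  set h : ℕ → ℝ := fun k => if k < m₀ then a k * G k else 0 with hh
  set h' : ℕ → ℝ := fun k => if k < m₀ then a k * Bs else 0 with hh'
  set φ : ℕ → ℝ := fun k => if m₁ ≤ k then 1 else 0 with hφ
  have hmlr : ∀ i j, i ≤ j → h j * h' i ≤ h i * h' j := by
    intro i j hij
    simp only [hh, hh']
    by_cases hj : j < m₀
    · have hi : i < m₀ := lt_of_le_of_lt hij hj
      rw [if_pos hj, if_pos hi, if_pos hi, if_pos hj]
      have hGij : G j ≤ G i := hvG_anti J b hb t hij
      have : 0 ≤ a i * a j * Bs := mul_nonneg (mul_nonneg (ha i) (ha j)) hBs0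
      nlinarith
    · rw [if_neg hj, if_neg hj, zero_mul, mul_zero]
  have hφmono : ∀ i j, i ≤ j → j < K + 1 → (h i ≠ 0 ∨ h' i ≠ 0) → (h j ≠ 0 ∨ h' j ≠ 0) → φ i ≤ φ j := by
    intro i j hij _ _ _
    simp only [hφ]
    by_cases hi : m₁ ≤ i
    · rw [if_pos hi, if_pos (le_trans hi hij)]
    · rw [if_neg hi]; split_ifs <;> norm_num
  have key := ThreshGrid.mlr_sum_le (K + 1) h h' φ hmlr hφmono
  -- Σ h φ = Σ h − Σ_{k<m₁} a G   etc.
  have splitH : ∑ k ∈ range (K + 1), h k * φ k = ∑ k ∈ range (K + 1), h k - ∑ k ∈ range (K + 1), (if k < m₁ then a k * G k else 0) := by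
    rw [eq_sub_iff_add_eq, ← Finset.sum_add_distrib]
    refine Finset.sum_congr rfl fun k _ => ?_
    show (if k < m₀ then a k * G k else 0) * (if m₁ ≤ k then (1:ℝ) else 0) + (if k < m₁ then a k * G k else 0) =
      (if k < m₀ then a k * G k else 0)
    by_cases h1 : k < m₁
    · rw [if_pos (lt_of_lt_of_le h1 hm), if_neg (not_le.2 h1), if_pos h1]; ring
    · rw [if_pos (not_lt.1 h1), if_neg h1]; ring
  have splitH' : ∑ k ∈ range (K + 1), h' k * φ k = ∑ k ∈ range (K + 1), h' k - ∑ k ∈ range (K + 1), (if k < m₁ then a k * Bs else 0) := by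
    rw [eq_sub_iff_add_eq, ← Finset.sum_add_distrib]
    refine Finset.sum_congr rfl fun k _ => ?_
    show (if k < m₀ then a k * Bs else 0) * (if m₁ ≤ k then (1:ℝ) else 0) + (if k < m₁ then a k * Bs else 0) =
      (if k < m₀ then a k * Bs else 0)
    by_cases h1 : k < m₁
    · rw [if_pos (lt_of_lt_of_le h1 hm), if_neg (not_le.2 h1), if_pos h1]; ring
    · rw [if_pos (not_lt.1 h1), if_neg h1]; ring
  rw [splitH, splitH'] at key
  -- key : (Σ h')(Σ h − SA(m₁)) ≤ (Σ h)(Σ h' − SD(m₁))  ⟹  (Σ h)·SD(m₁) ≤ (Σ h')·SA(m₁)... i.e. the claim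
  nlinarith [key]


/-! ## Measure versions: LEMMA X and LEMMA Ψ for nested thresholds of a sub-block -/

section Measure

open Literature.Probability.Percolation (DeterminedBy)
open Literature.Probability.LatticeModels (prodBernoulli)
open Literature.Probability.Percolation.DecisionTree (ind)

variable {ι : Type*} [Fintype ι] [DecidableEq ι]

omit [Fintype ι] [DecidableEq ι] in
/-- The layer `{N_T = #T + 1}` is empty. [folklore] -/
theorem real_layer_card_succ_eq_zero (p : ι → unitInterval) (T : Finset ι) :
    (prodBernoulli p).real {ω : Set ι | (T.filter (· ∈ ω)).card = T.card + 1} = 0 := by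
  have h : {ω : Set ι | (T.filter (· ∈ ω)).card = T.card + 1} = ∅ := by
    ext ω
    simp only [Set.mem_setOf_eq, Set.mem_empty_iff_false, iff_false]
    have := Finset.card_filter_le T (· ∈ ω)
    omega
  rw [h, measureReal_empty]

/-- Cell expansion of `μ({m ≤ N_T} ∩ {N_F < r})` for `T ⊆ F`. [folklore] -/
theorem real_thresh_inter_ball_eq_sum (p : ι → unitInterval) (F : Finset ι) {T : Finset ι} (hTF : T ⊆ F) (m r : ℕ) :
    (prodBernoulli p).real ({ω : Set ι | m ≤ (T.filter (· ∈ ω)).card} ∩ {ω : Set ι | (F.filter (· ∈ ω)).card < r}) =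
      ∑ k ∈ range (T.card + 1), ∑ j ∈ range ((F \ T).card + 1),
        (if m ≤ k ∧ k + j < r then (prodBernoulli p).real {ω : Set ι | (T.filter (· ∈ ω)).card = k} *
          (prodBernoulli p).real {ω : Set ι | ((F \ T).filter (· ∈ ω)).card = j} else 0) := by
  rw [real_eq_sum_cells p T (F \ T)]
  refine Finset.sum_congr rfl fun k _ => Finset.sum_congr rfl fun j _ => ?_
  rw [← real_cell_eq_mul p (Finset.disjoint_sdiff) k j]
  exact real_inter_cell_eq_ite p T (F \ T) (V := Set.univ) (P := m ≤ k ∧ k + j < r) fun ω hk hj => by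
    simp only [Set.mem_inter_iff, Set.mem_setOf_eq, Set.mem_univ, and_true]
    rw [card_filter_mem_eq_add F hTF ω, hk, hj]

/-- Cell expansion of `μ{N_F < r}` for `T ⊆ F`. [folklore] -/
theorem real_ball_eq_sum_cells (p : ι → unitInterval) (F : Finset ι) {T : Finset ι} (hTF : T ⊆ F) (r : ℕ) :
    (prodBernoulli p).real {ω : Set ι | (F.filter (· ∈ ω)).card < r} =
      ∑ k ∈ range (T.card + 1), ∑ j ∈ range ((F \ T).card + 1),
        (if k + j < r then (prodBernoulli p).real {ω : Set ι | (T.filter (· ∈ ω)).card = k} *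
          (prodBernoulli p).real {ω : Set ι | ((F \ T).filter (· ∈ ω)).card = j} else 0) := by
  rw [real_eq_sum_cells p T (F \ T)]
  refine Finset.sum_congr rfl fun k _ => Finset.sum_congr rfl fun j _ => ?_
  rw [← real_cell_eq_mul p (Finset.disjoint_sdiff) k j]
  exact real_inter_cell_eq_ite p T (F \ T) (V := Set.univ) (P := k + j < r) fun ω hk hj => by
    simp only [Set.mem_setOf_eq, Set.mem_univ, and_true]
    rw [card_filter_mem_eq_add F hTF ω, hk, hj]

/-- Cell expansion of `μ({N_T < m} ∩ {N_F < r})` for `T ⊆ F`. [folklore] -/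
theorem real_low_inter_ball_eq_sum (p : ι → unitInterval) (F : Finset ι) {T : Finset ι} (hTF : T ⊆ F) (m r : ℕ) :
    (prodBernoulli p).real ({ω : Set ι | (T.filter (· ∈ ω)).card < m} ∩ {ω : Set ι | (F.filter (· ∈ ω)).card < r}) =
      ∑ k ∈ range (T.card + 1), ∑ j ∈ range ((F \ T).card + 1),
        (if k < m ∧ k + j < r then (prodBernoulli p).real {ω : Set ι | (T.filter (· ∈ ω)).card = k} *
          (prodBernoulli p).real {ω : Set ι | ((F \ T).filter (· ∈ ω)).card = j} else 0) := by
  rw [real_eq_sum_cells p T (F \ T)]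
  refine Finset.sum_congr rfl fun k _ => Finset.sum_congr rfl fun j _ => ?_
  rw [← real_cell_eq_mul p (Finset.disjoint_sdiff) k j]
  exact real_inter_cell_eq_ite p T (F \ T) (V := Set.univ) (P := k < m ∧ k + j < r) fun ω hk hj => by
    simp only [Set.mem_inter_iff, Set.mem_setOf_eq, Set.mem_univ, and_true]
    rw [card_filter_mem_eq_add F hTF ω, hk, hj]

/-- Cell expansion of `μ{N_T < m}` (with the trivial second block `F ∖ T`). [folklore] -/
theorem real_low_eq_sum (p : ι → unitInterval) (F : Finset ι) (T : Finset ι) (m : ℕ) :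
    (prodBernoulli p).real {ω : Set ι | (T.filter (· ∈ ω)).card < m} =
      ∑ k ∈ range (T.card + 1), ∑ j ∈ range ((F \ T).card + 1),
        (if k < m then (prodBernoulli p).real {ω : Set ι | (T.filter (· ∈ ω)).card = k} *
          (prodBernoulli p).real {ω : Set ι | ((F \ T).filter (· ∈ ω)).card = j} else 0) := by
  rw [real_eq_sum_cells p T (F \ T)]
  refine Finset.sum_congr rfl fun k _ => Finset.sum_congr rfl fun j _ => ?_
  rw [← real_cell_eq_mul p (Finset.disjoint_sdiff) k j]
  exact real_inter_cell_eq_ite p T (F \ T) (V := Set.univ) (P := k < m) fun ω hk _ => by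
    simp only [Set.mem_setOf_eq, Set.mem_univ, and_true]
    rw [hk]

/-- **LEMMA X** (the pivot helps a one-heavy-voter threshold inside the ball): for `T ⊆ F` and all `m, t`,
`μ{N_F < t}·μ({N_T ≥ m+1} ∩ {N_F < t+1}) ≤ μ{N_F < t+1}·μ({N_T ≥ m} ∩ {N_F < t})` — log-concavity of the law of `N_T`
(`real_layer_logConcave`) and the MLR tail comparison. [this work] -/
theorem real_ball_mul_threshSucc_inter_ball_le (p : ι → unitInterval) (F : Finset ι) {T : Finset ι} (hTF : T ⊆ F) (m t : ℕ) :
    (prodBernoulli p).real {ω : Set ι | (F.filter (· ∈ ω)).card < t} *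
        (prodBernoulli p).real ({ω : Set ι | m + 1 ≤ (T.filter (· ∈ ω)).card} ∩ {ω : Set ι | (F.filter (· ∈ ω)).card < t + 1}) ≤
      (prodBernoulli p).real {ω : Set ι | (F.filter (· ∈ ω)).card < t + 1} *
        (prodBernoulli p).real ({ω : Set ι | m ≤ (T.filter (· ∈ ω)).card} ∩ {ω : Set ι | (F.filter (· ∈ ω)).card < t}) := by
  rw [real_ball_eq_sum_cells p F hTF t, real_thresh_inter_ball_eq_sum p F hTF (m + 1) (t + 1),
    real_ball_eq_sum_cells p F hTF (t + 1), real_thresh_inter_ball_eq_sum p F hTF m t]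
  refine hv_gridX T.card (F \ T).card _ _ (fun k => measureReal_nonneg) (fun j => measureReal_nonneg)
    (fun i j hij => real_layer_logConcave p T hij) (real_layer_card_succ_eq_zero p T) m t

/-- **LEMMA (a)**: `μ({N_T < m₀} ∩ {N_F < t})·μ{N_T < m₁} ≤ μ({N_T < m₁} ∩ {N_F < t})·μ{N_T < m₀}` for `m₁ ≤ m₀`, `T ⊆ F`
(conditioning the sub-block count to be smaller makes the ball likelier). [this work] -/
theorem real_low_inter_ball_mul_le (p : ι → unitInterval) (F : Finset ι) {T : Finset ι} (hTF : T ⊆ F) {m₁ m₀ : ℕ}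
    (hm : m₁ ≤ m₀) (t : ℕ) :
    (prodBernoulli p).real ({ω : Set ι | (T.filter (· ∈ ω)).card < m₀} ∩ {ω : Set ι | (F.filter (· ∈ ω)).card < t}) *
        (prodBernoulli p).real {ω : Set ι | (T.filter (· ∈ ω)).card < m₁} ≤
      (prodBernoulli p).real ({ω : Set ι | (T.filter (· ∈ ω)).card < m₁} ∩ {ω : Set ι | (F.filter (· ∈ ω)).card < t}) *
        (prodBernoulli p).real {ω : Set ι | (T.filter (· ∈ ω)).card < m₀} := by
  rw [real_low_inter_ball_eq_sum p F hTF m₀ t, real_low_eq_sum p F T m₁, real_low_inter_ball_eq_sum p F hTF m₁ t,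
    real_low_eq_sum p F T m₀]
  exact hv_gridA T.card (F \ T).card _ _ (fun k => measureReal_nonneg) (fun j => measureReal_nonneg) hm t

/-- **LEMMA Ψ for nested thresholds of a sub-block** (`T ⊆ F`, `m₁ ≤ m₀`, `B^y = {N_T ≥ m_y}`, `L¹ = {N_F < t}`, `L⁰ = {N_F < t+1}`):
`ℓ¹(1−b¹)(ℓ⁰b⁰ − μ(B⁰∩L⁰)) ≤ ℓ⁰(1−b⁰)(ℓ¹b¹ − μ(B¹∩L¹))`. [this work] -/
theorem heavyVoter_psi (p : ι → unitInterval) (F : Finset ι) {T : Finset ι} (hTF : T ⊆ F) {m₁ m₀ : ℕ} (hm : m₁ ≤ m₀) (t : ℕ) :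
    (prodBernoulli p).real {ω : Set ι | (F.filter (· ∈ ω)).card < t} *
        (1 - (prodBernoulli p).real {ω : Set ι | m₁ ≤ (T.filter (· ∈ ω)).card}) *
        ((prodBernoulli p).real {ω : Set ι | (F.filter (· ∈ ω)).card < t + 1} *
            (prodBernoulli p).real {ω : Set ι | m₀ ≤ (T.filter (· ∈ ω)).card} -
          (prodBernoulli p).real ({ω : Set ι | m₀ ≤ (T.filter (· ∈ ω)).card} ∩ {ω : Set ι | (F.filter (· ∈ ω)).card < t + 1})) ≤
      (prodBernoulli p).real {ω : Set ι | (F.filter (· ∈ ω)).card < t + 1} *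
        (1 - (prodBernoulli p).real {ω : Set ι | m₀ ≤ (T.filter (· ∈ ω)).card}) *
        ((prodBernoulli p).real {ω : Set ι | (F.filter (· ∈ ω)).card < t} *
            (prodBernoulli p).real {ω : Set ι | m₁ ≤ (T.filter (· ∈ ω)).card} -
          (prodBernoulli p).real ({ω : Set ι | m₁ ≤ (T.filter (· ∈ ω)).card} ∩ {ω : Set ι | (F.filter (· ∈ ω)).card < t})) := by
  set μ := prodBernoulli p with hμ
  set L1 : Set (Set ι) := {ω : Set ι | (F.filter (· ∈ ω)).card < t} with hL1
  set L0 : Set (Set ι) := {ω : Set ι | (F.filter (· ∈ ω)).card < t + 1} with hL0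
  set B1 : Set (Set ι) := {ω : Set ι | m₁ ≤ (T.filter (· ∈ ω)).card} with hB1
  set B0 : Set (Set ι) := {ω : Set ι | m₀ ≤ (T.filter (· ∈ ω)).card} with hB0
  set D1 : Set (Set ι) := {ω : Set ι | (T.filter (· ∈ ω)).card < m₁} with hD1
  set D0 : Set (Set ι) := {ω : Set ι | (T.filter (· ∈ ω)).card < m₀} with hD0
  -- complements: μ D^y = 1 − μ B^y, μ(D^y ∩ L) = μ L − μ(B^y ∩ L)
  have cD : ∀ m' : ℕ, ∀ X : Set (Set ι), X \ {ω : Set ι | m' ≤ (T.filter (· ∈ ω)).card} = X ∩ {ω : Set ι | (T.filter (· ∈ ω)).card < m'} :=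
    fun m' X => by ext ω; simp only [Set.mem_sdiff, Set.mem_inter_iff, Set.mem_setOf_eq, not_le]
  have splitU : ∀ m' : ℕ, μ.real {ω : Set ι | (T.filter (· ∈ ω)).card < m'} = 1 - μ.real {ω : Set ι | m' ≤ (T.filter (· ∈ ω)).card} := by
    intro m'
    have h := measureReal_inter_add_sdiff (μ := μ) (s := Set.univ) (t := {ω : Set ι | m' ≤ (T.filter (· ∈ ω)).card})
      MeasurableSet.of_discrete
    rw [Set.univ_inter, cD, Set.univ_inter, probReal_univ] at h; linarith
  have splitL : ∀ (m' : ℕ) (X : Set (Set ι)), μ.real ({ω : Set ι | (T.filter (· ∈ ω)).card < m'} ∩ X) =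
      μ.real X - μ.real ({ω : Set ι | m' ≤ (T.filter (· ∈ ω)).card} ∩ X) := by
    intro m' X
    have h := measureReal_inter_add_sdiff (μ := μ) (s := X) (t := {ω : Set ι | m' ≤ (T.filter (· ∈ ω)).card})
      MeasurableSet.of_discrete
    rw [cD, Set.inter_comm X, Set.inter_comm X] at h; linarith
  -- (a) and (b)
  have ha := real_low_inter_ball_mul_le p F hTF hm t
  have hb := real_inter_ball_mul_le_succ p F (isUpperSet_threshold T m₀) t
  rw [splitL m₀ L1, splitL m₁ L1, splitU m₁, splitU m₀] at ha
  -- now everything is in terms of B-measures; nonnegativity facts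
  have hl1 : 0 ≤ μ.real L1 := measureReal_nonneg
  have hl0 : 0 ≤ μ.real L0 := measureReal_nonneg
  have hb1le : μ.real B1 ≤ 1 := by rw [← probReal_univ (μ := μ)]; exact measureReal_mono (Set.subset_univ _)
  have hb0le : μ.real B0 ≤ 1 := by rw [← probReal_univ (μ := μ)]; exact measureReal_mono (Set.subset_univ _)
  have hB0L1le : μ.real (B0 ∩ L1) ≤ μ.real L1 := measureReal_mono Set.inter_subset_right
  have hB0L0le : μ.real (B0 ∩ L0) ≤ μ.real L0 := measureReal_mono Set.inter_subset_right
  have hl10 : μ.real L1 ≤ μ.real L0 := measureReal_mono fun ω (hω : (F.filter (· ∈ ω)).card < t) => by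
    simp only [hL0, Set.mem_setOf_eq]; omega
  -- (a): (μL1 − μ(B0∩L1))·(1 − b1) ≤ (μL1 − μ(B1∩L1))·(1 − b0)
  -- (b): μ(B0∩L1)·μL0 ≤ μ(B0∩L0)·μL1  ⟹  (μL1 − μ(B0∩L1))·μL0 ≥ (μL0 − μ(B0∩L0))·μL1
  change μ.real (B0 ∩ L1) * μ.real L0 ≤ μ.real (B0 ∩ L0) * μ.real L1 at hb
  nlinarith [mul_le_mul_of_nonneg_left ha hl0, mul_nonneg hl1 (sub_nonneg.2 hb1le), hb, hB0L1le, hB0L0le,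
    mul_le_mul_of_nonneg_right hb (sub_nonneg.2 hb1le)]

end Measure

end SahiOneStep

end Summit.CriticalPhenomena.PercolationContinuityZ3.Theorems
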